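import Summits.ValiantsHypothesis.ValiantsHypothesis.Theorems.FeketeSOSFeketeSOSHardPaleyRIPTameStatus
import Summits.ValiantsHypothesis.ValiantsHypothesis.Theorems.FeketeSOSFeketeSOSHardPaleyRIPTameFold
import Summits.ValiantsHypothesis.ValiantsHypothesis.Theses.FeketeSOS

/-!
# Route FeketeSOS — crux `FeketeSOSHard` (stmt-ValiantsHypothesis-3996), line `paley-rip` (skeleton v3):
# the TRADE-OFF composition — flat-RIP at exponent `κ` plus operator tameness at exponent `γ` prove the crux
# whenever `κ > (γ − 1)/2`

The registered skeleton `Cruxes/FeketeSOSHard/Lines/paley_rip_v3.lean` composes the engine B = `stub_paleyFlatRIP`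
(`∃ κ > 0 …`) with operator tameness T = `stub_tameOperator` at exponent `1 + ε` for EVERY `ε`.  The repair census
(`Lines/paley-rip-stub3-census.md` §5) records that the two exponents trade off: writing `T_γ` for "weighted squares
supported in `S` with cyclic pattern of modulus `≤ M` can be replaced, inside `S`, by squares of mass
`≤ K · r^K · #S^γ · M`" and `B_κ` for flat-RIP of the Paley–Hankel form with exponent `κ` on `p^{1/2+δ₁}`-sparse
supports, one has

  `B_κ ∧ T_γ ⇒ FeketeSOSHard`   as soon as   `κ > (γ − 1)/2`

(`γ = 3/2` is unconditional by spectral spreading but would need the impossible `κ > 1/4`; `γ = 1 + ε` pairs with every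
`κ > 0`; `γ = 5/4` with `κ > 1/8`).  This file proves that implication SORRY-FREE with both hypotheses inline
(`feketeSOSHard_of_flatRIP_of_tameOperator_gamma`), so that any future theorem `T_γ` with `γ < 3/2` (even at bounded
rank growth `r ≤ p^δ`) converts the crux into flat-RIP at a NAMED exponent.  Parameter choice: `g := κ − (γ−1)/2 > 0`,
`δ := min(δ₁, g/(2(K+γ+1)))`, `η := κ − g/4`, threshold `p ≥ max(p₁, ⌈K^{4/g}⌉, ⌈2^{4/g}⌉, 3)`.

Also recorded: the bookkeeping lemmas of the skeleton under importable names (`jointSupport_fold`,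
`coeff_fek_norm_le_one`, `fek_natDegree_lt`, `natDegree_lt_of_subset_range`, `le_rpow_of_rpow_le_nat`).
Honest framing: neither B nor any `T_γ` with `γ < 3/2` is proved; the crux stays OPEN; `VP ≠ VNP` untouched.
-/

set_option linter.dupNamespace false

namespace Summit.ValiantsHypothesis.ValiantsHypothesis.Theorems.FeketeSOSHardPaleyRIP

open Polynomial Finset
open scoped BigOperators
open Summit.ValiantsHypothesis.ValiantsHypothesis.Theses

noncomputable section

section Bookkeeping

variable (p : ℕ) [Fact p.Prime]

/-- The coefficients of the Fekete polynomial have modulus `≤ 1`. [folklore] -/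
theorem coeff_fek_norm_le_one (n : ℕ) : ‖(fek p).coeff n‖ ≤ 1 := by
  classical
  unfold fek
  rw [finsetSum_coeff]
  simp only [coeff_C_mul_X_pow]
  rw [Finset.sum_ite_eq (range p) n]
  split_ifs
  · exact norm_chiC_le_one p _
  · simp

/-- `deg F_p < p`. [folklore] -/
theorem fek_natDegree_lt : (fek p).natDegree < p := by
  have hp : 0 < p := (Fact.out : p.Prime).pos
  unfold fek
  refine lt_of_le_of_lt (natDegree_sum_le_of_forall_le (n := p - 1) (range p) _ fun m hm => ?_)
    (Nat.sub_lt hp one_pos)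
  refine (natDegree_C_mul_X_pow_le _ m).trans ?_
  have := mem_range.1 hm
  omega

omit [Fact p.Prime] in
/-- A polynomial supported inside `S ⊆ [0,p)` has degree `< p`. [folklore] -/
theorem natDegree_lt_of_subset_range (hp : 0 < p) {S : Finset ℕ} (hS : ∀ a ∈ S, a < p)
    {w : ℂ[X]} (hw : w.support ⊆ S) : w.natDegree < p := by
  by_cases h0 : w = 0
  · rw [h0, natDegree_zero]; exact hp
  · exact hS _ (hw (natDegree_mem_support_of_nonzero h0))

/-- Joint-support fold: from `X^p − 1 ∣ Σ_i c_i g_i² − F_p` (any degrees) to squares `g'_i` with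
`supp g'_i ⊆ S ⊆ [0,p)`, `#S ≤ Σ_i #supp g_i`, and the same cyclic pattern. [folklore] -/
theorem jointSupport_fold (s : ℕ) (c : Fin s → ℂ) (g : Fin s → ℂ[X])
    (hdvd : (X : ℂ[X]) ^ p - 1 ∣ (∑ i, C (c i) * g i ^ 2) - fek p) :
    ∃ (S : Finset ℕ) (g' : Fin s → ℂ[X]), (∀ a ∈ S, a < p) ∧ (∀ j, (g' j).support ⊆ S) ∧
      ((S.card : ℝ) ≤ ∑ i, ((g i).support.card : ℝ)) ∧
      ((X : ℂ[X]) ^ p - 1 ∣ (∑ j, C (c j) * g' j ^ 2) - fek p) := by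
  classical
  obtain ⟨g', hdeg', hcard', hdvd'⟩ := exists_cyclic_fold p s c g hdvd
  refine ⟨Finset.univ.biUnion fun j => (g' j).support, g', ?_, ?_, ?_, hdvd'⟩
  · intro a ha
    obtain ⟨j, -, hj⟩ := Finset.mem_biUnion.1 ha
    exact lt_of_le_of_lt (le_natDegree_of_mem_supp a hj) (hdeg' j)
  · intro j a ha
    exact Finset.mem_biUnion.2 ⟨j, Finset.mem_univ j, ha⟩
  · calc ((Finset.univ.biUnion fun j => (g' j).support).card : ℝ)
        ≤ ∑ j, ((g' j).support.card : ℝ) := by exact_mod_cast Finset.card_biUnion_le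
      _ ≤ ∑ i, ((g i).support.card : ℝ) := sum_le_sum fun j _ => by exact_mod_cast hcard' j

omit [Fact p.Prime] in
/-- `K ≤ p^{a}` once `K^{1/a} ≤ N ≤ p` (`a, K > 0`). [folklore] -/
theorem le_rpow_of_rpow_le_nat {a K : ℝ} (ha : 0 < a) (hK : 0 < K) (N : ℕ) (hN : K ^ (1 / a) ≤ (N : ℝ))
    (hpN : N ≤ p) : K ≤ (p : ℝ) ^ a := by
  have hbase : K ^ (1 / a) ≤ (p : ℝ) := hN.trans (by exact_mod_cast hpN)
  have h0 : (0 : ℝ) ≤ K ^ (1 / a) := Real.rpow_nonneg hK.le _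
  have hmono : (K ^ (1 / a)) ^ a ≤ (p : ℝ) ^ a := Real.rpow_le_rpow h0 hbase ha.le
  have hid : (K ^ (1 / a)) ^ a = K := by
    rw [← Real.rpow_mul hK.le]
    have : (1 / a) * a = 1 := by field_simp
    rw [this, Real.rpow_one]
  rw [hid] at hmono
  exact hmono

omit [Fact p.Prime] in
/-- Exponent bookkeeping for the trade-off: with `0 < δ`, `2δ(K+γ+1) ≤ g`, `0 ≤ γ`, `s ≤ p^δ`, `m ≤ p^{1/2+δ}` and
`K ≤ p^{g/4}`: `K · s^K · m^γ ≤ p^{γ/2 + 3g/4}`. [folklore] -/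
theorem tradeoff_mass_le {g γ δ K s m : ℝ} (hp : 1 < (p : ℝ)) (hγ : 0 ≤ γ) (hK : 0 < K)
    (hδ : 0 < δ) (hδle : δ * (2 * (K + γ + 1)) ≤ g) (hs0 : 0 ≤ s) (hs : s ≤ (p : ℝ) ^ δ)
    (hm0 : 0 ≤ m) (hm : m ≤ (p : ℝ) ^ (1 / 2 + δ)) (hKp : K ≤ (p : ℝ) ^ (g / 4)) :
    K * s ^ K * m ^ γ ≤ (p : ℝ) ^ (γ / 2 + 3 * g / 4) := by
  have hp0 : (0 : ℝ) < p := by linarith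
  have h1 : s ^ K ≤ (p : ℝ) ^ (δ * K) := by
    rw [Real.rpow_mul hp0.le]
    exact Real.rpow_le_rpow hs0 hs hK.le
  have h2 : m ^ γ ≤ (p : ℝ) ^ ((1 / 2 + δ) * γ) := by
    rw [Real.rpow_mul hp0.le]
    exact Real.rpow_le_rpow hm0 hm hγ
  have hA : K * s ^ K ≤ (p : ℝ) ^ (g / 4) * (p : ℝ) ^ (δ * K) :=
    mul_le_mul hKp h1 (Real.rpow_nonneg hs0 _) (Real.rpow_nonneg hp0.le _)
  have hprod : K * s ^ K * m ^ γ ≤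
      ((p : ℝ) ^ (g / 4) * (p : ℝ) ^ (δ * K)) * (p : ℝ) ^ ((1 / 2 + δ) * γ) :=
    mul_le_mul hA h2 (Real.rpow_nonneg hm0 _)
      (mul_nonneg (Real.rpow_nonneg hp0.le _) (Real.rpow_nonneg hp0.le _))
  rw [← Real.rpow_add hp0, ← Real.rpow_add hp0] at hprod
  refine hprod.trans (Real.rpow_le_rpow_of_exponent_le hp.le ?_)
  have hexp : (1 / 2 + δ) * γ = γ / 2 + δ * γ := by ring
  have hδle' : 2 * (δ * K) + 2 * (δ * γ) + 2 * δ ≤ g := by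
    have e : δ * (2 * (K + γ + 1)) = 2 * (δ * K) + 2 * (δ * γ) + 2 * δ := by ring
    rw [e] at hδle; exact hδle
  rw [hexp]
  nlinarith [mul_nonneg hδ.le hγ, mul_nonneg hδ.le hK.le]

end Bookkeeping

/-! ## The trade-off composition -/

/-- **`B_κ ∧ T_γ ⇒ X` whenever `κ > (γ−1)/2`.**  Flat-RIP of the Paley–Hankel form with exponents `(κ, δ₁)`
beyond a threshold, together with operator tameness at exponent `γ ≥ 0` (constant `K`: every family of `r`
weighted squares supported in `S ⊆ [0,p)` with cyclic pattern of modulus `≤ M` is replaceable inside `S` by squares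
of mass `≤ K·r^K·#S^γ·M`), proves `FeketeSOSHard`, provided `(γ − 1)/2 < κ` (no positivity of `κ` is needed beyond this).  For `γ = 1 + ε` this is the
registered v3 composition; for `γ ∈ (1, 3/2)` it is the trade-off curve of the census (§5). [folklore] -/
theorem feketeSOSHard_of_flatRIP_of_tameOperator_gamma (κ δ₁ γ K : ℝ) (hδ₁ : 0 < δ₁)
    (hγ : 0 ≤ γ) (hK : 0 < K) (hgap : (γ - 1) / 2 < κ)
    (hB : ∃ p₁ : ℕ, ∀ (p : ℕ) [Fact p.Prime], p₁ ≤ p →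
      ∀ (S : Finset ℕ), (∀ a ∈ S, a < p) → (S.card : ℝ) ≤ (p : ℝ) ^ (1 / 2 + δ₁) →
      ∀ (w : ℕ → ℂ), ‖paleyForm p S w‖ ≤ (p : ℝ) ^ (1 / 2 - κ) * ∑ a ∈ S, ‖w a‖ ^ 2)
    (hT : ∀ (p : ℕ) [Fact p.Prime] (r : ℕ) (S : Finset ℕ), (∀ a ∈ S, a < p) →
      ∀ (c : Fin r → ℂ) (w : Fin r → ℂ[X]), (∀ i, (w i).support ⊆ S) →
      ∀ (F : ℂ[X]) (M : ℝ), F.natDegree < p → ((X : ℂ[X]) ^ p - 1 ∣ (∑ i, C (c i) * w i ^ 2) - F) →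
        (∀ n, ‖F.coeff n‖ ≤ M) →
        ∃ (s' : ℕ) (c' : Fin s' → ℂ) (w' : Fin s' → ℂ[X]), (∀ j, (w' j).support ⊆ S) ∧
          ((X : ℂ[X]) ^ p - 1 ∣ (∑ j, C (c' j) * w' j ^ 2) - F) ∧
          (∑ j, sqMass (c' j) (w' j)) ≤ K * (r : ℝ) ^ K * (S.card : ℝ) ^ γ * M) :
    FeketeSOS.FeketeSOSHard := by
  classical
  obtain ⟨p₁, hB⟩ := hB
  -- the gap and the parameters
  set g : ℝ := κ - (γ - 1) / 2 with hgdef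
  have hg : 0 < g := by rw [hgdef]; linarith
  set δ : ℝ := min δ₁ (g / (2 * (K + γ + 1))) with hδdef
  have h2K : (0 : ℝ) < 2 * (K + γ + 1) := by positivity
  have hδ : 0 < δ := lt_min hδ₁ (div_pos hg h2K)
  have hδ₁' : δ ≤ δ₁ := min_le_left _ _
  have hδle : δ * (2 * (K + γ + 1)) ≤ g := by
    have h : δ ≤ g / (2 * (K + γ + 1)) := min_le_right _ _
    rwa [le_div_iff₀ h2K] at h
  set η : ℝ := κ - g / 4 with hηdef
  have hηκ : η < κ := by rw [hηdef]; linarith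
  obtain ⟨N₁, hN₁⟩ : ∃ N : ℕ, K ^ (1 / (g / 4)) ≤ (N : ℝ) := ⟨_, Nat.le_ceil _⟩
  obtain ⟨N₂, hN₂⟩ : ∃ N : ℕ, (2 : ℝ) ^ (1 / (κ - η)) ≤ (N : ℝ) := ⟨_, Nat.le_ceil _⟩
  refine ⟨δ, hδ, max p₁ (max N₁ (max N₂ 3)), ?_⟩
  intro p _ hp s c g₀ hs hdeg hrep
  have hprime : p.Prime := Fact.out
  have hp₁ : p₁ ≤ p := le_trans (le_max_left _ _) hp
  have hpN₁ : N₁ ≤ p := le_trans (le_trans (le_max_left _ _) (le_max_right _ _)) hp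
  have hpN₂ : N₂ ≤ p :=
    le_trans (le_trans (le_trans (le_max_left _ _) (le_max_right _ _)) (le_max_right _ _)) hp
  have hp3 : 3 ≤ p :=
    le_trans (le_trans (le_trans (le_max_right _ _) (le_max_right _ _)) (le_max_right _ _)) hp
  have hp1 : (1 : ℝ) < (p : ℝ) := by exact_mod_cast hprime.one_lt
  have hp0 : (0 : ℝ) < (p : ℝ) := by linarith
  by_contra hlt
  have hlt' : (∑ i, ((g₀ i).support.card : ℝ)) < (p : ℝ) ^ (1 / 2 + δ) := not_le.1 hlt
  -- fold to one joint support
  have hdvd : (X : ℂ[X]) ^ p - 1 ∣ (∑ i, C (c i) * g₀ i ^ 2) - fek p := by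
    have hrep' : (∑ i, C (c i) * g₀ i ^ 2) = fek p := by rw [hrep]; rfl
    rw [hrep', sub_self]; exact dvd_zero _
  obtain ⟨S, g', hS, hsuppS, hcardS, hdvd'⟩ := jointSupport_fold p s c g₀ hdvd
  have hcardS' : (S.card : ℝ) ≤ (p : ℝ) ^ (1 / 2 + δ) := (hcardS.trans_lt hlt').le
  -- operator tameness with F = F_p, M = 1
  obtain ⟨s', c', w', hsupp', hdvd'', hmass⟩ :=
    hT p s S hS c g' hsuppS (fek p) 1 (fek_natDegree_lt p) hdvd' (coeff_fek_norm_le_one p)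
  have hKp : K ≤ (p : ℝ) ^ (g / 4) := le_rpow_of_rpow_le_nat p (by positivity) hK N₁ hN₁ hpN₁
  have hmass' : (∑ j, sqMass (c' j) (w' j)) ≤ (p : ℝ) ^ (1 / 2 + η) := by
    have h := tradeoff_mass_le (p := p) hp1 hγ hK hδ hδle (Nat.cast_nonneg s) hs
      (Nat.cast_nonneg S.card) hcardS' hKp
    have hexp : γ / 2 + 3 * g / 4 = 1 / 2 + η := by rw [hηdef, hgdef]; ring
    calc (∑ j, sqMass (c' j) (w' j)) ≤ K * (s : ℝ) ^ K * (S.card : ℝ) ^ γ * 1 := hmass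
      _ = K * (s : ℝ) ^ K * (S.card : ℝ) ^ γ := mul_one _
      _ ≤ (p : ℝ) ^ (γ / 2 + 3 * g / 4) := h
      _ = (p : ℝ) ^ (1 / 2 + η) := by rw [hexp]
  -- the new squares are `p^{1/2+δ₁}`-sparse of degree `< p`
  have hdeg'' : ∀ j, (w' j).natDegree < p := fun j =>
    natDegree_lt_of_subset_range p hprime.pos hS (hsupp' j)
  have hsuppcard : ∀ j, ((w' j).support.card : ℝ) ≤ (p : ℝ) ^ (1 / 2 + δ₁) := by
    intro j
    calc ((w' j).support.card : ℝ) ≤ (S.card : ℝ) := by exact_mod_cast Finset.card_le_card (hsupp' j)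
      _ ≤ (p : ℝ) ^ (1 / 2 + δ) := hcardS'
      _ ≤ (p : ℝ) ^ (1 / 2 + δ₁) := Real.rpow_le_rpow_of_exponent_le hp1.le (by linarith)
  -- flat-RIP gap and contradiction
  have hgap' := rpow_gap (p := p) hηκ N₂ hN₂ hpN₂ hp3
  have hgt := mass_gt_of_flatRIPAt p κ δ₁ η (hB p hp₁) hgap' s' c' w' hdeg'' hsuppcard hdvd''
  linarith

end

end Summit.ValiantsHypothesis.ValiantsHypothesis.Theorems.FeketeSOSHardPaleyRIP
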